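import Summits.BirchSwinnertonDyer.BirchSwinnertonDyer.Theorems.ByReductionTypeAtTwoSupersingularFlatCountClassKitZero
import Summits.BirchSwinnertonDyer.BirchSwinnertonDyer.Theorems.ByReductionTypeAtTwoSupersingularColemanClass107217l
import Summits.BirchSwinnertonDyer.BirchSwinnertonDyer.Theorems.ByReductionTypeAtTwoSupersingularColemanClass184041bk
import HarnessLib

/-!
# The ♭ door / kit for the `2`-adically NON-surjective good-supersingular classes (μ♭ branch: `μ(X♭) = 0`
# displayed instead of a Dokchitser–Dokchitser certificate) with EC♭@2 DISCHARGED, and the two `a₂ = 0`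
# non-surjective classes `107217l`, `184041bk` on Sprung's ♭ road

Seat `bsd-2adic-ss-1` GEN 10, crux `SupersingularRankZeroAtTwo` (item stmt-BirchSwinnertonDyer-19097, route
`ByReductionTypeAtTwo`, rung K4). The `a₂ = 0` sub-row has 2/208 classes with proper mod-`4` image (`107217l`, `184041bk`,
`j = −4t³(t+8)`; landed GEN 8 on the ± road as `SSColemanRoad.bsdp_two_<label>_of_signedUpper`, binder = the Kato-side
signed divisibility itself). On the ♭ road the guarded clause F4@(2) is replaced by `μ(X♭) = 0` (v8/v9 stub (5′), CONJ):
`SSFlatRoad.flatUpper_two_of_flatColemanKato_of_mu` (GEN 9). With EC♭@2 PRODUCED (`flatEulerChar_two`, GEN 10):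
* `bsdp_two_of_flatCountColemanKato_mu_of_pow_dvd` — the door WITHOUT `TwoAdicSurjective`, with `hμ` (μ♭ = 0 for every
  ♭ dual datum of the supplied data);
* `bsdp_two_baseChange_int_of_flatCountColemanKato_mu_zero` — the integer-model kit on `a₂ = 0` (`#M̃(𝔽₂) = 3`), no DD
  certificates;
* `bsdp_two_107217l1_of_flatCountColemanKato_mu`, `bsdp_two_184041bk1_of_flatCountColemanKato_mu` — the two classes,
  kernel inputs (`Δ`, `#Ẽ(𝔽₂) = 3`) re-used from the landed `…ColemanClass<cls>.lean`.
Displayed: PRINT {`hmod`, `hGZK`, `h124`, `hX0`}; Honda₂ clauses of the supplied data; READ-AT-2 {COUNT♭@2, CK♭@2};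
CONJ {μ♭ = 0}; CERT {`L(E,1) ≠ 0`, `#Ш_an = 16`, `2⁴ ∣ #Ш`}. With these two the whole `a₂ = 0` sub-row (208/208) has a
♭-road display. HONEST FRAMING: class-instance shapes; closes nothing; no census cell moves; BSD is not proved by any
of this.

References: [Sprung2024] §5.2 Lemmas 5.5–5.9; [Sprung2012] Thm. 2.2 (2′), Lemma 2.3, Prop. 7.3, Thm. 7.14, 7.16,
Prop. 7.19; [Kato2004Asterisque] Thm. 12.4–12.5; [SilvermanAEC2009] VII.5 Prop. 5.1(a); [Miller2011LMS] Def. 1.1;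
[CremonaAlgorithms1997] Table 1 (107217l1, 184041bk1).
-/

set_option autoImplicit false
-- the Theorems namespace of this sub repeats the summit name by design (D-0017 nested layout)
set_option linter.dupNamespace false

noncomputable section

open scoped Classical MatrixGroups ModularForm NumberField
open NumberField IsDedekindDomain CongruenceSubgroup WeierstrassCurve Literature.NumberTheory.EllipticCurves
  Literature.NumberTheory.EllipticCurves.ModularForms Literature.NumberTheory.EllipticCurves.Sprung2017
  Literature.NumberTheory.EllipticCurves.Rank1Residual Literature.NumberTheory.EllipticCurves.Rank1Residual.Typed
  Literature.NumberTheory.EllipticCurves.Sprung2012 Literature.NumberTheory.EllipticCurves.IwasawaDual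
  Literature.NumberTheory.EllipticCurves.Kobayashi2003 Literature.NumberTheory.GaloisRepresentations
  ZpExtension Summit.BirchSwinnertonDyer.Rank1Residual Summit.BirchSwinnertonDyer.Rank1Residual.Supersingular
  Summit.BirchSwinnertonDyer.Rank1Residual.X5 Summit.BirchSwinnertonDyer.Rank1Residual.X5.O1
  Summit.BirchSwinnertonDyer.Rank1Residual.X5.Instances

namespace Summit.BirchSwinnertonDyer.BirchSwinnertonDyer.Theorems
namespace SSFlatRoad

/-! ## §1 The μ♭ door with EC♭ discharged -/

/-- **`BSD(E, 2)` on the ♭ road, μ♭ branch, EC♭ PRODUCED** — `bsdp_two_of_flatUpper_of_pow_dvd` fed by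
`flatUpper_two_of_flatColemanKato_of_mu` (no `2`-adic image hypothesis; `hμ` : `μ(X♭) = 0` for every ♭ dual datum of
the data) and `flatEulerChar_two` (EC♭@2 from the Honda₂ clauses + COUNT♭@2). PUB {`hmod`, `hGZK`, `h124`, `hX0`}; CK♭
(`hCK`); CERT {`L(E,1) ≠ 0`, `#Ш_an = q`, `v₂ q ≤ m`, `2^m ∣ #Ш`}. Any `a₂ ∈ {0, ±2}`.
[cite: Sprung2024, §5.2 Lemmas 5.5–5.9] [cite: Sprung2012, Thm. 2.2 (2′), Lemma 2.3, Thm. 7.14, 7.16]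
[cite: Kato2004Asterisque, Thm. 12.4–12.5] [cite: Miller2011LMS, Def. 1.1] -/
theorem bsdp_two_of_flatCountColemanKato_mu_of_pow_dvd (W : WeierstrassCurve ℚ) [W.IsElliptic] [W.IsGloballyMinimal]
    {κ : ZpExtension ℚ 2} {γ : Field.absoluteGaloisGroup ℚ} {v : HeightOneSpectrum (𝓞 ℚ)}
    (g : Field.absoluteGaloisGroup (v.adicCompletion ℚ)) (c : ℕ → localPoints W (v.adicCompletion ℚ))
    (hmod : nonempty_modularParametrizationData)
    (hGZK : rank_eq_analyticRank_of_analyticRank_le_one)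
    (h124 : Kato2004.thm12_4) (hX0 : Kato2004_fineSelmerDual_isTorsion)
    (hgood : W.HasGoodReductionAtPrime 2) (hss : (2 : ℤ) ∣ W.frobeniusTrace 2)
    (hL : W.entireLFunction 1 ≠ 0)
    (hκ : κ.IsCyclotomic) (hγ : κ.IsTopGenerator γ)
    (hv : (2 : 𝓞 ℚ) ∈ v.asIdeal)
    (hg : κ.IsTopGenerator (resGalOfEmb (closureEmb (K := ℚ) (v.adicCompletion ℚ)) g))
    (hc : ∀ n, c n ∈ localLayerPointsOfEmb κ (closureEmb (K := ℚ) (v.adicCompletion ℚ)) W n)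
    (hTr : ∀ n, 1 ≤ n → localTraceOfEmb κ (closureEmb (K := ℚ) (v.adicCompletion ℚ)) W n (n + 1)
      (c (n + 1)) = W.frobeniusTrace 2 • c n - c (n - 1))
    (hinj : ∀ z₀ : localLayerPointsOfEmb κ (closureEmb (K := ℚ) (v.adicCompletion ℚ)) W 0 →+ ℤ_[2],
      evalOn W (localLayerPointsOfEmb κ (closureEmb (K := ℚ) (v.adicCompletion ℚ)) W 0) z₀ (c 0) = 0 →
        z₀ = 0)
    (hsat : ∀ a : ℤ_[2],
      (∃ z₀ : localLayerPointsOfEmb κ (closureEmb (K := ℚ) (v.adicCompletion ℚ)) W 0 →+ ℤ_[2],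
        evalOn W (localLayerPointsOfEmb κ (closureEmb (K := ℚ) (v.adicCompletion ℚ)) W 0) z₀ (c 0) =
          2 * a) →
      ∃ y : localLayerPointsOfEmb κ (closureEmb (K := ℚ) (v.adicCompletion ℚ)) W 0 →+ ℤ_[2],
        evalOn W (localLayerPointsOfEmb κ (closureEmb (K := ℚ) (v.adicCompletion ℚ)) W 0) y (c 0) = a)
    (hcount : Finite (W.selmerGroupPInfty 2) →
      Finite (EndCoinvariants (conjSharpFlatSelmerInfty W κ (closureEmb (K := ℚ) (v.adicCompletion ℚ))
        (W.frobeniusTrace 2) g c .flat γ - 1)) →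
      Nat.card (↥((sharpFlatSelmerInfty W κ (closureEmb (K := ℚ) (v.adicCompletion ℚ))
            (W.frobeniusTrace 2) g c .flat).comap (W.layerToInfty κ 0)) ⧸
          (W.selmerLayer κ 0).addSubgroupOf
            ((sharpFlatSelmerInfty W κ (closureEmb (K := ℚ) (v.adicCompletion ℚ))
              (W.frobeniusTrace 2) g c .flat).comap (W.layerToInfty κ 0))) *
        Nat.card (MulAction.fixedPoints (Field.absoluteGaloisGroup ℚ) (W.geomPrimaryTorsion 2)) =
      2 ^ (padicValNat 2 W.tamagawaProduct) *
        Nat.card (EndCoinvariants (conjSharpFlatSelmerInfty W κ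
          (closureEmb (K := ℚ) (v.adicCompletion ℚ)) (W.frobeniusTrace 2) g c .flat γ - 1)))
    (hCK : ∀ [NeZero (W.conductorNorm ℤ)] (f : CuspForm (Gamma0 (W.conductorNorm ℤ)) 2),
        IsNewformOf W f → ∀ (ϖ : ℚ), (ϖ : ℝ) * W.realPeriodRat = plusPeriod f →
      ∀ (Ls Lf : IwasawaAlgebra 2), IsSprungPair f 2 (W.frobeniusTrace 2) Ls Lf →
      ∀ (D : SharpFlatSelmerDualData W κ γ (closureEmb (K := ℚ) (v.adicCompletion ℚ))
          (W.frobeniusTrace 2) g c .flat)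
        [ContinuousSMul ℤ_[2] (W.tateModule 2)],
        ∃ (I : Kato2004.IwasawaH1Data W 2 κ γ) (Y : W.FineSelmerDualData κ γ)
          (P : Submodule (IwasawaAlgebra 2) (IwasawaAlgebra 2))
          (loc : I.H →ₗ[IwasawaAlgebra 2] P) (toX : P →ₗ[IwasawaAlgebra 2] D.X)
          (δ : D.X →ₗ[IwasawaAlgebra 2] Y.X) (Z : Submodule (IwasawaAlgebra 2) I.H)
          (G : IwasawaAlgebra 2),
          Function.Exact loc toX ∧ Function.Exact toX δ ∧
          G ∈ Submodule.map (P.subtype ∘ₗ loc) Z ∧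
          iwasawaToPowerSeries 2 G = PowerSeries.C (ϖ : ℚ_[2]) * iwasawaToPowerSeries 2 Lf ∧
          (∀ 𝔭 : PrimeSpectrum (IwasawaAlgebra 2), 𝔭.asIdeal.height = 1 →
            PowerSeries.C (2 : ℤ_[2]) ∉ 𝔭.asIdeal →
            Literature.NumberTheory.EllipticCurves.Module.lengthAt (IwasawaAlgebra 2) Y.X 𝔭 ≤
              Literature.NumberTheory.EllipticCurves.Module.lengthAt (IwasawaAlgebra 2) (I.H ⧸ Z) 𝔭) ∧
          (TwoAdicSurjective W →
            ∀ 𝔭 : PrimeSpectrum (IwasawaAlgebra 2), 𝔭.asIdeal.height = 1 →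
              PowerSeries.C (2 : ℤ_[2]) ∈ 𝔭.asIdeal →
              Literature.NumberTheory.EllipticCurves.Module.lengthAt (IwasawaAlgebra 2) Y.X 𝔭 ≤
                Literature.NumberTheory.EllipticCurves.Module.lengthAt (IwasawaAlgebra 2) (I.H ⧸ Z) 𝔭))
    (hμ : ∀ (D : SharpFlatSelmerDualData W κ γ (closureEmb (K := ℚ) (v.adicCompletion ℚ))
        (W.frobeniusTrace 2) g c .flat) (g' : IwasawaAlgebra 2),
      D.charIdeal = Ideal.span {g'} → ¬ PowerSeries.C (2 : ℤ_[2]) ∣ g')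
    {q : ℚ} (hq : shaAn W = (q : ℂ)) {m : ℕ} (hvq : padicValRat 2 q ≤ m)
    (hdvd : 2 ^ m ∣ W.shaOrder) : BSDp W 2 :=
  bsdp_two_of_flatUpper_of_pow_dvd W (closureEmb (K := ℚ) (v.adicCompletion ℚ)) g c hmod hGZK hgood hss hL hγ
    (fun D _ hX f hf hfin ↦ flatEulerChar_two W ⟨hgood, hss⟩ κ hγ hv hg hc hTr hinj hsat hcount D hX f hf hfin)
    (flatUpper_two_of_flatColemanKato_of_mu W (closureEmb (K := ℚ) (v.adicCompletion ℚ)) g c h124 hX0 hgood hss hL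
      hκ hγ hCK hμ) hq hvq hdvd

/-! ## §2 The integer-model kit, `a₂ = 0`, μ♭ branch -/

/-- **`BSD(E, 2)` for `E = M ⊗ ℚ` on the ♭ road, `a₂ = 0`, μ♭ branch, EC♭ DISCHARGED** — for the `2`-adically
NON-surjective `a₂ = 0` classes: KERNEL inputs `Δ(M) = D` odd, `#M̃(𝔽₂) = 3`, `2^(m+1) ∤ Q`; displayed PRINT {`hmod`,
`hGZK`, `h124`, `hX0`}; for the supplied `(κ, γ, v ∋ 2, g, c)`: Honda₂ clauses, READ-AT-2 {COUNT♭@2, CK♭@2}, CONJ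
{μ♭ = 0}; CERT {`L(E,1) ≠ 0`, `#Ш_an = Q`, `2^m ∣ #Ш`}. Closes nothing by itself.
[cite: Sprung2024, §5.2 Lemmas 5.5–5.9] [cite: Sprung2012, Thm. 2.2 (2′), Lemma 2.3, Thm. 7.14, 7.16 and Prop. 7.19]
[cite: Kato2004Asterisque, Thm. 12.4–12.5] [cite: SilvermanAEC2009, VII.5 Prop. 5.1(a)] [cite: Miller2011LMS, Def. 1.1] -/
theorem bsdp_two_baseChange_int_of_flatCountColemanKato_mu_zero (M : WeierstrassCurve ℤ) {D : ℤ} (hΔ : M.Δ = D)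
    (h2 : ¬ (2 : ℤ) ∣ D) (hcard : Nat.card (M.map (Int.castRingHom (ZMod 2))).toAffine.Point = 3)
    {Q m : ℕ} (hQ : Q ≠ 0) (hQm : ¬ 2 ^ (m + 1) ∣ Q)
    (hmod : nonempty_modularParametrizationData)
    (hGZK : rank_eq_analyticRank_of_analyticRank_le_one)
    (h124 : Kato2004.thm12_4) (hX0 : Kato2004_fineSelmerDual_isTorsion) :
    ∀ (W : WeierstrassCurve ℚ) [W.IsElliptic] [W.IsGloballyMinimal], W = M.baseChange ℚ →
    ∀ (κ : ZpExtension ℚ 2) (γ : Field.absoluteGaloisGroup ℚ), κ.IsCyclotomic → κ.IsTopGenerator γ →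
    ∀ (v : HeightOneSpectrum (𝓞 ℚ)), (2 : 𝓞 ℚ) ∈ v.asIdeal →
    ∀ (g : Field.absoluteGaloisGroup (v.adicCompletion ℚ)) (c : ℕ → localPoints W (v.adicCompletion ℚ)),
      κ.IsTopGenerator (resGalOfEmb (closureEmb (K := ℚ) (v.adicCompletion ℚ)) g) →
    (∀ n, c n ∈ localLayerPointsOfEmb κ (closureEmb (K := ℚ) (v.adicCompletion ℚ)) W n) →
    (∀ n, 1 ≤ n → localTraceOfEmb κ (closureEmb (K := ℚ) (v.adicCompletion ℚ)) W n (n + 1)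
      (c (n + 1)) = W.frobeniusTrace 2 • c n - c (n - 1)) →
    (∀ z₀ : localLayerPointsOfEmb κ (closureEmb (K := ℚ) (v.adicCompletion ℚ)) W 0 →+ ℤ_[2],
      evalOn W (localLayerPointsOfEmb κ (closureEmb (K := ℚ) (v.adicCompletion ℚ)) W 0) z₀ (c 0) = 0 →
        z₀ = 0) →
    (∀ a : ℤ_[2],
      (∃ z₀ : localLayerPointsOfEmb κ (closureEmb (K := ℚ) (v.adicCompletion ℚ)) W 0 →+ ℤ_[2],
        evalOn W (localLayerPointsOfEmb κ (closureEmb (K := ℚ) (v.adicCompletion ℚ)) W 0) z₀ (c 0) =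
          2 * a) →
      ∃ y : localLayerPointsOfEmb κ (closureEmb (K := ℚ) (v.adicCompletion ℚ)) W 0 →+ ℤ_[2],
        evalOn W (localLayerPointsOfEmb κ (closureEmb (K := ℚ) (v.adicCompletion ℚ)) W 0) y (c 0) = a) →
    (Finite (W.selmerGroupPInfty 2) →
      Finite (EndCoinvariants (conjSharpFlatSelmerInfty W κ (closureEmb (K := ℚ) (v.adicCompletion ℚ))
        (W.frobeniusTrace 2) g c .flat γ - 1)) →
      Nat.card (↥((sharpFlatSelmerInfty W κ (closureEmb (K := ℚ) (v.adicCompletion ℚ))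
            (W.frobeniusTrace 2) g c .flat).comap (W.layerToInfty κ 0)) ⧸
          (W.selmerLayer κ 0).addSubgroupOf
            ((sharpFlatSelmerInfty W κ (closureEmb (K := ℚ) (v.adicCompletion ℚ))
              (W.frobeniusTrace 2) g c .flat).comap (W.layerToInfty κ 0))) *
        Nat.card (MulAction.fixedPoints (Field.absoluteGaloisGroup ℚ) (W.geomPrimaryTorsion 2)) =
      2 ^ (padicValNat 2 W.tamagawaProduct) *
        Nat.card (EndCoinvariants (conjSharpFlatSelmerInfty W κ
          (closureEmb (K := ℚ) (v.adicCompletion ℚ)) (W.frobeniusTrace 2) g c .flat γ - 1))) →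
    (∀ [NeZero (W.conductorNorm ℤ)] (f : CuspForm (Gamma0 (W.conductorNorm ℤ)) 2),
        IsNewformOf W f → ∀ (ϖ : ℚ), (ϖ : ℝ) * W.realPeriodRat = plusPeriod f →
      ∀ (Ls Lf : IwasawaAlgebra 2), IsSprungPair f 2 (W.frobeniusTrace 2) Ls Lf →
      ∀ (D : SharpFlatSelmerDualData W κ γ (closureEmb (K := ℚ) (v.adicCompletion ℚ))
          (W.frobeniusTrace 2) g c .flat)
        [ContinuousSMul ℤ_[2] (W.tateModule 2)],
        ∃ (I : Kato2004.IwasawaH1Data W 2 κ γ) (Y : W.FineSelmerDualData κ γ)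
          (P : Submodule (IwasawaAlgebra 2) (IwasawaAlgebra 2))
          (loc : I.H →ₗ[IwasawaAlgebra 2] P) (toX : P →ₗ[IwasawaAlgebra 2] D.X)
          (δ : D.X →ₗ[IwasawaAlgebra 2] Y.X) (Z : Submodule (IwasawaAlgebra 2) I.H)
          (G : IwasawaAlgebra 2),
          Function.Exact loc toX ∧ Function.Exact toX δ ∧
          G ∈ Submodule.map (P.subtype ∘ₗ loc) Z ∧
          iwasawaToPowerSeries 2 G = PowerSeries.C (ϖ : ℚ_[2]) * iwasawaToPowerSeries 2 Lf ∧
          (∀ 𝔭 : PrimeSpectrum (IwasawaAlgebra 2), 𝔭.asIdeal.height = 1 →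
            PowerSeries.C (2 : ℤ_[2]) ∉ 𝔭.asIdeal →
            Literature.NumberTheory.EllipticCurves.Module.lengthAt (IwasawaAlgebra 2) Y.X 𝔭 ≤
              Literature.NumberTheory.EllipticCurves.Module.lengthAt (IwasawaAlgebra 2) (I.H ⧸ Z) 𝔭) ∧
          (TwoAdicSurjective W →
            ∀ 𝔭 : PrimeSpectrum (IwasawaAlgebra 2), 𝔭.asIdeal.height = 1 →
              PowerSeries.C (2 : ℤ_[2]) ∈ 𝔭.asIdeal →
              Literature.NumberTheory.EllipticCurves.Module.lengthAt (IwasawaAlgebra 2) Y.X 𝔭 ≤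
                Literature.NumberTheory.EllipticCurves.Module.lengthAt (IwasawaAlgebra 2) (I.H ⧸ Z) 𝔭)) →
    (∀ (D : SharpFlatSelmerDualData W κ γ (closureEmb (K := ℚ) (v.adicCompletion ℚ))
        (W.frobeniusTrace 2) g c .flat) (g' : IwasawaAlgebra 2),
      D.charIdeal = Ideal.span {g'} → ¬ PowerSeries.C (2 : ℤ_[2]) ∣ g') →
    W.entireLFunction 1 ≠ 0 → shaAn W = ((Q : ℚ) : ℂ) → 2 ^ m ∣ W.shaOrder → BSDp W 2 := by
  intro W _ _ hW κ γ hκ hγ v hv g c hg hc hTr hinj hsat hcount hCK hμ hL hq hdvd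
  subst hW
  obtain ⟨hgood, ha, hss⟩ := SSColemanRoad.goodSS_two_baseChange_int_of_card_three M (by rwa [hΔ]) hcard
  exact bsdp_two_of_flatCountColemanKato_mu_of_pow_dvd _ g c hmod hGZK h124 hX0 hgood hss.2 hL hκ hγ hv hg hc hTr
    hinj hsat hcount hCK hμ hq (SSColemanRoad.padicValRat_two_natCast_le hQ hQm) hdvd

/-! ## §3 The two non-surjective `a₂ = 0` classes -/

/-- **`BSD(107217l1, 2)` ON SPRUNG'S ♭ ROAD (`a₂ = 0`, μ♭ branch), EC♭ DISCHARGED** — the `2`-adically NON-surjective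
`a₂ = 0` class **107217l** (landed GEN 8 as `SSColemanRoad.bsdp_two_107217l1_of_signedUpper`): PRINT {`hmod`, `hGZK`, `h124`, `hX0`};
Honda₂ clauses of the supplied data; READ-AT-2 {COUNT♭@2, CK♭@2}; CONJ {μ♭ = 0}; CERT {`L(E,1) ≠ 0`, `#Ш_an = 16`,
`2⁴ ∣ #Ш`}. KERNEL (re-used): `Δ = -644917394591146602833787`, `#Ẽ(𝔽₂) = 3`, `2⁵ ∤ 16`. Closes nothing by itself.
[cite: Sprung2012, Thm. 2.2 (2′), Thm. 7.14, 7.16] [cite: Sprung2024, §5.2 Lemmas 5.5–5.9] [cite: CremonaAlgorithms1997, Table 1]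
[cite: Miller2011LMS, Def. 1.1] -/
theorem bsdp_two_107217l1_of_flatCountColemanKato_mu
    (hmod : nonempty_modularParametrizationData)
    (hGZK : rank_eq_analyticRank_of_analyticRank_le_one)
    (h124 : Kato2004.thm12_4) (hX0 : Kato2004_fineSelmerDual_isTorsion) :
    ∀ (W : WeierstrassCurve ℚ) [W.IsElliptic] [W.IsGloballyMinimal],
      W = (⟨0, 0, 1, 2592702, -38604175324⟩ : WeierstrassCurve ℤ).baseChange ℚ →
    ∀ (κ : ZpExtension ℚ 2) (γ : Field.absoluteGaloisGroup ℚ), κ.IsCyclotomic → κ.IsTopGenerator γ →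
    ∀ (v : HeightOneSpectrum (𝓞 ℚ)), (2 : 𝓞 ℚ) ∈ v.asIdeal →
    ∀ (g : Field.absoluteGaloisGroup (v.adicCompletion ℚ)) (c : ℕ → localPoints W (v.adicCompletion ℚ)),
      κ.IsTopGenerator (resGalOfEmb (closureEmb (K := ℚ) (v.adicCompletion ℚ)) g) →
    (∀ n, c n ∈ localLayerPointsOfEmb κ (closureEmb (K := ℚ) (v.adicCompletion ℚ)) W n) →
    (∀ n, 1 ≤ n → localTraceOfEmb κ (closureEmb (K := ℚ) (v.adicCompletion ℚ)) W n (n + 1)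
      (c (n + 1)) = W.frobeniusTrace 2 • c n - c (n - 1)) →
    (∀ z₀ : localLayerPointsOfEmb κ (closureEmb (K := ℚ) (v.adicCompletion ℚ)) W 0 →+ ℤ_[2],
      evalOn W (localLayerPointsOfEmb κ (closureEmb (K := ℚ) (v.adicCompletion ℚ)) W 0) z₀ (c 0) = 0 →
        z₀ = 0) →
    (∀ a : ℤ_[2],
      (∃ z₀ : localLayerPointsOfEmb κ (closureEmb (K := ℚ) (v.adicCompletion ℚ)) W 0 →+ ℤ_[2],
        evalOn W (localLayerPointsOfEmb κ (closureEmb (K := ℚ) (v.adicCompletion ℚ)) W 0) z₀ (c 0) =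
          2 * a) →
      ∃ y : localLayerPointsOfEmb κ (closureEmb (K := ℚ) (v.adicCompletion ℚ)) W 0 →+ ℤ_[2],
        evalOn W (localLayerPointsOfEmb κ (closureEmb (K := ℚ) (v.adicCompletion ℚ)) W 0) y (c 0) = a) →
    (Finite (W.selmerGroupPInfty 2) →
      Finite (EndCoinvariants (conjSharpFlatSelmerInfty W κ (closureEmb (K := ℚ) (v.adicCompletion ℚ))
        (W.frobeniusTrace 2) g c .flat γ - 1)) →
      Nat.card (↥((sharpFlatSelmerInfty W κ (closureEmb (K := ℚ) (v.adicCompletion ℚ))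
            (W.frobeniusTrace 2) g c .flat).comap (W.layerToInfty κ 0)) ⧸
          (W.selmerLayer κ 0).addSubgroupOf
            ((sharpFlatSelmerInfty W κ (closureEmb (K := ℚ) (v.adicCompletion ℚ))
              (W.frobeniusTrace 2) g c .flat).comap (W.layerToInfty κ 0))) *
        Nat.card (MulAction.fixedPoints (Field.absoluteGaloisGroup ℚ) (W.geomPrimaryTorsion 2)) =
      2 ^ (padicValNat 2 W.tamagawaProduct) *
        Nat.card (EndCoinvariants (conjSharpFlatSelmerInfty W κ
          (closureEmb (K := ℚ) (v.adicCompletion ℚ)) (W.frobeniusTrace 2) g c .flat γ - 1))) →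
    (∀ [NeZero (W.conductorNorm ℤ)] (f : CuspForm (Gamma0 (W.conductorNorm ℤ)) 2),
        IsNewformOf W f → ∀ (ϖ : ℚ), (ϖ : ℝ) * W.realPeriodRat = plusPeriod f →
      ∀ (Ls Lf : IwasawaAlgebra 2), IsSprungPair f 2 (W.frobeniusTrace 2) Ls Lf →
      ∀ (D : SharpFlatSelmerDualData W κ γ (closureEmb (K := ℚ) (v.adicCompletion ℚ))
          (W.frobeniusTrace 2) g c .flat)
        [ContinuousSMul ℤ_[2] (W.tateModule 2)],
        ∃ (I : Kato2004.IwasawaH1Data W 2 κ γ) (Y : W.FineSelmerDualData κ γ)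
          (P : Submodule (IwasawaAlgebra 2) (IwasawaAlgebra 2))
          (loc : I.H →ₗ[IwasawaAlgebra 2] P) (toX : P →ₗ[IwasawaAlgebra 2] D.X)
          (δ : D.X →ₗ[IwasawaAlgebra 2] Y.X) (Z : Submodule (IwasawaAlgebra 2) I.H)
          (G : IwasawaAlgebra 2),
          Function.Exact loc toX ∧ Function.Exact toX δ ∧
          G ∈ Submodule.map (P.subtype ∘ₗ loc) Z ∧
          iwasawaToPowerSeries 2 G = PowerSeries.C (ϖ : ℚ_[2]) * iwasawaToPowerSeries 2 Lf ∧
          (∀ 𝔭 : PrimeSpectrum (IwasawaAlgebra 2), 𝔭.asIdeal.height = 1 →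
            PowerSeries.C (2 : ℤ_[2]) ∉ 𝔭.asIdeal →
            Literature.NumberTheory.EllipticCurves.Module.lengthAt (IwasawaAlgebra 2) Y.X 𝔭 ≤
              Literature.NumberTheory.EllipticCurves.Module.lengthAt (IwasawaAlgebra 2) (I.H ⧸ Z) 𝔭) ∧
          (TwoAdicSurjective W →
            ∀ 𝔭 : PrimeSpectrum (IwasawaAlgebra 2), 𝔭.asIdeal.height = 1 →
              PowerSeries.C (2 : ℤ_[2]) ∈ 𝔭.asIdeal →
              Literature.NumberTheory.EllipticCurves.Module.lengthAt (IwasawaAlgebra 2) Y.X 𝔭 ≤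
                Literature.NumberTheory.EllipticCurves.Module.lengthAt (IwasawaAlgebra 2) (I.H ⧸ Z) 𝔭)) →
    (∀ (D : SharpFlatSelmerDualData W κ γ (closureEmb (K := ℚ) (v.adicCompletion ℚ))
        (W.frobeniusTrace 2) g c .flat) (g' : IwasawaAlgebra 2),
      D.charIdeal = Ideal.span {g'} → ¬ PowerSeries.C (2 : ℤ_[2]) ∣ g') →
    W.entireLFunction 1 ≠ 0 → shaAn W = ((16 : ℕ) : ℚ) → 2 ^ 4 ∣ W.shaOrder → BSDp W 2 :=
  bsdp_two_baseChange_int_of_flatCountColemanKato_mu_zero _ SSColemanRoad.M107217l1_Δ (by decide) SSColemanRoad.card_F2_107217l1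
    (Q := 16) (m := 4) (by decide) (by decide) hmod hGZK h124 hX0

/-- **`BSD(184041bk1, 2)` ON SPRUNG'S ♭ ROAD (`a₂ = 0`, μ♭ branch), EC♭ DISCHARGED** — the `2`-adically NON-surjective
`a₂ = 0` class **184041bk** (landed GEN 8 as `SSColemanRoad.bsdp_two_184041bk1_of_signedUpper`): PRINT {`hmod`, `hGZK`, `h124`, `hX0`};
Honda₂ clauses of the supplied data; READ-AT-2 {COUNT♭@2, CK♭@2}; CONJ {μ♭ = 0}; CERT {`L(E,1) ≠ 0`, `#Ш_an = 16`,
`2⁴ ∣ #Ш`}. KERNEL (re-used): `Δ = -581656113102420753652827`, `#Ẽ(𝔽₂) = 3`, `2⁵ ∤ 16`. Closes nothing by itself.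
[cite: Sprung2012, Thm. 2.2 (2′), Thm. 7.14, 7.16] [cite: Sprung2024, §5.2 Lemmas 5.5–5.9] [cite: CremonaAlgorithms1997, Table 1]
[cite: Miller2011LMS, Def. 1.1] -/
theorem bsdp_two_184041bk1_of_flatCountColemanKato_mu
    (hmod : nonempty_modularParametrizationData)
    (hGZK : rank_eq_analyticRank_of_analyticRank_le_one)
    (h124 : Kato2004.thm12_4) (hX0 : Kato2004_fineSelmerDual_isTorsion) :
    ∀ (W : WeierstrassCurve ℚ) [W.IsElliptic] [W.IsGloballyMinimal],
      W = (⟨0, 0, 1, -36440118, -92277007144⟩ : WeierstrassCurve ℤ).baseChange ℚ →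
    ∀ (κ : ZpExtension ℚ 2) (γ : Field.absoluteGaloisGroup ℚ), κ.IsCyclotomic → κ.IsTopGenerator γ →
    ∀ (v : HeightOneSpectrum (𝓞 ℚ)), (2 : 𝓞 ℚ) ∈ v.asIdeal →
    ∀ (g : Field.absoluteGaloisGroup (v.adicCompletion ℚ)) (c : ℕ → localPoints W (v.adicCompletion ℚ)),
      κ.IsTopGenerator (resGalOfEmb (closureEmb (K := ℚ) (v.adicCompletion ℚ)) g) →
    (∀ n, c n ∈ localLayerPointsOfEmb κ (closureEmb (K := ℚ) (v.adicCompletion ℚ)) W n) →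
    (∀ n, 1 ≤ n → localTraceOfEmb κ (closureEmb (K := ℚ) (v.adicCompletion ℚ)) W n (n + 1)
      (c (n + 1)) = W.frobeniusTrace 2 • c n - c (n - 1)) →
    (∀ z₀ : localLayerPointsOfEmb κ (closureEmb (K := ℚ) (v.adicCompletion ℚ)) W 0 →+ ℤ_[2],
      evalOn W (localLayerPointsOfEmb κ (closureEmb (K := ℚ) (v.adicCompletion ℚ)) W 0) z₀ (c 0) = 0 →
        z₀ = 0) →
    (∀ a : ℤ_[2],
      (∃ z₀ : localLayerPointsOfEmb κ (closureEmb (K := ℚ) (v.adicCompletion ℚ)) W 0 →+ ℤ_[2],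
        evalOn W (localLayerPointsOfEmb κ (closureEmb (K := ℚ) (v.adicCompletion ℚ)) W 0) z₀ (c 0) =
          2 * a) →
      ∃ y : localLayerPointsOfEmb κ (closureEmb (K := ℚ) (v.adicCompletion ℚ)) W 0 →+ ℤ_[2],
        evalOn W (localLayerPointsOfEmb κ (closureEmb (K := ℚ) (v.adicCompletion ℚ)) W 0) y (c 0) = a) →
    (Finite (W.selmerGroupPInfty 2) →
      Finite (EndCoinvariants (conjSharpFlatSelmerInfty W κ (closureEmb (K := ℚ) (v.adicCompletion ℚ))
        (W.frobeniusTrace 2) g c .flat γ - 1)) →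
      Nat.card (↥((sharpFlatSelmerInfty W κ (closureEmb (K := ℚ) (v.adicCompletion ℚ))
            (W.frobeniusTrace 2) g c .flat).comap (W.layerToInfty κ 0)) ⧸
          (W.selmerLayer κ 0).addSubgroupOf
            ((sharpFlatSelmerInfty W κ (closureEmb (K := ℚ) (v.adicCompletion ℚ))
              (W.frobeniusTrace 2) g c .flat).comap (W.layerToInfty κ 0))) *
        Nat.card (MulAction.fixedPoints (Field.absoluteGaloisGroup ℚ) (W.geomPrimaryTorsion 2)) =
      2 ^ (padicValNat 2 W.tamagawaProduct) *
        Nat.card (EndCoinvariants (conjSharpFlatSelmerInfty W κ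
          (closureEmb (K := ℚ) (v.adicCompletion ℚ)) (W.frobeniusTrace 2) g c .flat γ - 1))) →
    (∀ [NeZero (W.conductorNorm ℤ)] (f : CuspForm (Gamma0 (W.conductorNorm ℤ)) 2),
        IsNewformOf W f → ∀ (ϖ : ℚ), (ϖ : ℝ) * W.realPeriodRat = plusPeriod f →
      ∀ (Ls Lf : IwasawaAlgebra 2), IsSprungPair f 2 (W.frobeniusTrace 2) Ls Lf →
      ∀ (D : SharpFlatSelmerDualData W κ γ (closureEmb (K := ℚ) (v.adicCompletion ℚ))
          (W.frobeniusTrace 2) g c .flat)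
        [ContinuousSMul ℤ_[2] (W.tateModule 2)],
        ∃ (I : Kato2004.IwasawaH1Data W 2 κ γ) (Y : W.FineSelmerDualData κ γ)
          (P : Submodule (IwasawaAlgebra 2) (IwasawaAlgebra 2))
          (loc : I.H →ₗ[IwasawaAlgebra 2] P) (toX : P →ₗ[IwasawaAlgebra 2] D.X)
          (δ : D.X →ₗ[IwasawaAlgebra 2] Y.X) (Z : Submodule (IwasawaAlgebra 2) I.H)
          (G : IwasawaAlgebra 2),
          Function.Exact loc toX ∧ Function.Exact toX δ ∧
          G ∈ Submodule.map (P.subtype ∘ₗ loc) Z ∧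
          iwasawaToPowerSeries 2 G = PowerSeries.C (ϖ : ℚ_[2]) * iwasawaToPowerSeries 2 Lf ∧
          (∀ 𝔭 : PrimeSpectrum (IwasawaAlgebra 2), 𝔭.asIdeal.height = 1 →
            PowerSeries.C (2 : ℤ_[2]) ∉ 𝔭.asIdeal →
            Literature.NumberTheory.EllipticCurves.Module.lengthAt (IwasawaAlgebra 2) Y.X 𝔭 ≤
              Literature.NumberTheory.EllipticCurves.Module.lengthAt (IwasawaAlgebra 2) (I.H ⧸ Z) 𝔭) ∧
          (TwoAdicSurjective W →
            ∀ 𝔭 : PrimeSpectrum (IwasawaAlgebra 2), 𝔭.asIdeal.height = 1 →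
              PowerSeries.C (2 : ℤ_[2]) ∈ 𝔭.asIdeal →
              Literature.NumberTheory.EllipticCurves.Module.lengthAt (IwasawaAlgebra 2) Y.X 𝔭 ≤
                Literature.NumberTheory.EllipticCurves.Module.lengthAt (IwasawaAlgebra 2) (I.H ⧸ Z) 𝔭)) →
    (∀ (D : SharpFlatSelmerDualData W κ γ (closureEmb (K := ℚ) (v.adicCompletion ℚ))
        (W.frobeniusTrace 2) g c .flat) (g' : IwasawaAlgebra 2),
      D.charIdeal = Ideal.span {g'} → ¬ PowerSeries.C (2 : ℤ_[2]) ∣ g') →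
    W.entireLFunction 1 ≠ 0 → shaAn W = ((16 : ℕ) : ℚ) → 2 ^ 4 ∣ W.shaOrder → BSDp W 2 :=
  bsdp_two_baseChange_int_of_flatCountColemanKato_mu_zero _ SSColemanRoad.M184041bk1_Δ (by decide) SSColemanRoad.card_F2_184041bk1
    (Q := 16) (m := 4) (by decide) (by decide) hmod hGZK h124 hX0

end SSFlatRoad
end Summit.BirchSwinnertonDyer.BirchSwinnertonDyer.Theorems

end
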